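import Literature.AlgebraicGeometry.Resolution.DefectAmbient
import Literature.AlgebraicGeometry.Resolution.DefectTransport
import Literature.AlgebraicGeometry.Resolution.HenselizationHenselian
import Mathlib.Algebra.CharP.Lemmas
import Mathlib.LinearAlgebra.FiniteDimensional.Lemmas
import HarnessLib

/-!
# Immediate extensions of defectless fields are separable (Knaf–Kuhlmann 2009, Lemma 3.12)

Stub S1b of the line `pfaff-line-log-final-forms` for the crux `Valuative.LuAlphaPTorsor`
(reshape v6.7): MacLane's form of H. Knaf, F.-V. Kuhlmann, *Every place admits local
uniformization in a finite extension of the function field*, Adv. Math. 221 (2009) 428–453 =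
arXiv:math/0702856, **Lemma 3.12** ("every immediate extension of a defectless field is
separable").

Setting: one valued field `(K, O)` of characteristic `p`, a subfield `F₀ ≤ K` such that
`(F₀, O ∩ F₀)` is a defectless valued field (`IsDefectlessField`) and `K` is dense over `F₀`
(hence `K/F₀` is immediate). Conclusion (`stub_denseLinearIndepOnPow`): `F₀`-linearly
independent finite subsets of `K` stay `F₀`-linearly independent after `p`-th powers.

Proof (inside `K`, by Frobenius). For a relation `Σ cₓ x^p = 0` (`cₓ ∈ F₀`) put `k' := F₀^p`
and `M := k'(cₓ : x) ≤ F₀`, a finite purely inseparable extension of `k'`; `(k', O ∩ k')` is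
defectless (isomorphic to `(F₀, O ∩ F₀)` by Frobenius) and `O ∩ M` is the only extension of
`O ∩ k'` to `M`, so `[M : k'] = e·f`. Choosing `aᵢ ∈ M` with values representing `vM/vk'` and
`bⱼ ∈ M ∩ O` with residues a `k'v`-basis of `Mv`, the `e·f` products `aᵢbⱼ` are `K^p`-linearly
independent by the tree's `linearIndependent_mul_of_valuation_of_residue`, because
`vK^p = vk'` and `K^p v = k'v` (immediacy of `K/F₀`); so they form a `k'`-basis of `M` which is
`K^p`-linearly independent, and expanding the `cₓ` in it kills the relation.
-/

set_option linter.dupNamespace false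

namespace Summit.ResolutionOfSingularities.ResolutionOfSingularities.Theorems.PfaffLine

open IsLocalRing Literature.AlgebraicGeometry.Resolution

/-- Stub S1b: **Knaf–Kuhlmann 2009, Lemma 3.12 in MacLane's form** — if `(F₀, O ∩ F₀)` is a
defectless valued field and `K ⊇ F₀` (characteristic `p`) is dense over `F₀`, then finitely many
`F₀`-linearly independent elements of `K` have `F₀`-linearly independent `p`-th powers.
[cite: KnafKuhlmann2009, Lemma 3.12] -/
theorem stub_denseLinearIndepOnPow :
    ∀ p : ℕ, p.Prime → ∀ (K : Type) [Field K] [CharP K p] (O : ValuationSubring K) (F₀ : Subfield K), Literature.AlgebraicGeometry.Resolution.IsDefectlessField ↥F₀ (O.comap (algebraMap ↥F₀ K)) → (∀ x w : K, w ≠ 0 → ∃ a ∈ F₀, O.valuation (x - a) < O.valuation w) → ∀ s : Finset K, LinearIndepOn ↥F₀ _root_.id (s : Set K) → LinearIndepOn ↥F₀ (fun x : K => x ^ p) (s : Set K) := by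
  intro p hp K _ _ O F₀ hdef hd s hs
  classical
  haveI : Fact p.Prime := ⟨hp⟩
  have hp0 : p ≠ 0 := hp.ne_zero
  -- Frobenius, `K^p` and `k' = F₀^p`
  have hφ : ∀ x : K, frobenius K p x = x ^ p := fun x => frobenius_def p x
  have hφinj : Function.Injective (frobenius K p) := frobenius_inj K p
  have hk'Kp : F₀.map (frobenius K p) ≤ (frobenius K p).fieldRange := by
    rintro _ ⟨x, -, rfl⟩
    exact ⟨x, rfl⟩
  -- (A) `(k', O ∩ k')` is defectless, being isomorphic to `(F₀, O ∩ F₀)`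
  have hdef' : IsDefectlessField ↥(F₀.map (frobenius K p))
      (O.comap (algebraMap ↥(F₀.map (frobenius K p)) K)) := by
    let ψ : ↥F₀ ≃+* ↥(F₀.map (frobenius K p)) := RingEquiv.ofBijective
      ((frobenius K p).restrict F₀ (F₀.map (frobenius K p)) fun x hx =>
        Subfield.mem_map.mpr ⟨x, hx, rfl⟩)
      ⟨fun x y h => Subtype.ext (hφinj (congrArg Subtype.val h)), fun y => by
        obtain ⟨x, hx, hxy⟩ := Subfield.mem_map.mp y.2
        exact ⟨⟨x, hx⟩, Subtype.ext hxy⟩⟩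
    refine IsDefectlessField.congr ψ ?_ hdef
    ext x
    simp only [ValuationSubring.mem_comap]
    exact (pow_mem_iff_mem O hp0 (x : K)).symm
  -- (D) immediacy: `vK^p ⊆ vk'` and `K^p v ⊆ k'v`
  have hH : ∀ c : K, c ∈ (frobenius K p).fieldRange → (hc : c ≠ 0) →
      Units.mk0 (O.valuation c) ((Valuation.ne_zero_iff _).mpr hc) ∈
        valueSubgroup ↥(F₀.map (frobenius K p)) O := by
    rintro _ ⟨x, rfl⟩ hc
    have hx : x ≠ 0 := fun h => hc (by rw [hφ, h, zero_pow hp0])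
    obtain ⟨a, haF, hxa⟩ := hd x x hx
    have hva : O.valuation a = O.valuation x := by
      rw [← Valuation.map_sub_eq_of_lt_left _ hxa, sub_sub_cancel]
    have ha0 : a ≠ 0 := fun h => (Valuation.ne_zero_iff _ |>.mpr hx) (by rw [← hva, h, map_zero])
    refine (mem_valueSubgroup_iff _ O _).mpr ⟨⟨a ^ p, Subfield.mem_map.mpr ⟨a, haF, hφ a⟩⟩,
      fun h => pow_ne_zero p ha0 (congrArg Subtype.val h), ?_⟩
    change O.valuation (frobenius K p x) = O.valuation (a ^ p)
    rw [hφ, map_pow, map_pow, hva]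
  have hL : ∀ c : K, c ∈ (frobenius K p).fieldRange → (hc : c ∈ O) →
      residue O ⟨c, hc⟩ ∈ residueSubfield ↥(F₀.map (frobenius K p)) O := by
    rintro _ ⟨x, rfl⟩ hc
    have hxO : x ∈ O := (pow_mem_iff_mem O hp0 x).mp (by rw [← hφ]; exact hc)
    obtain ⟨a, haF, hxa⟩ := hd x 1 one_ne_zero
    rw [map_one] at hxa
    have hxaO : x - a ∈ O := (O.valuation_le_one_iff _).mp hxa.le
    have haO : a ∈ O := by
      have := sub_mem hxO hxaO
      rwa [sub_sub_cancel] at this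
    have hapO : a ^ p ∈ O := pow_mem haO p
    refine (mem_residueSubfield_iff _ O _).mpr
      ⟨⟨a ^ p, Subfield.mem_map.mpr ⟨a, haF, hφ a⟩⟩, hapO, ?_⟩
    change residue O ⟨a ^ p, hapO⟩ = residue O ⟨frobenius K p x, hc⟩
    rw [← sub_eq_zero, ← map_sub, residue_eq_zero_iff, ValuationSubring.valuation_lt_one_iff]
    change O.valuation (a ^ p - frobenius K p x) < 1
    rw [hφ, ← sub_pow_char, map_pow, ← Valuation.map_neg, neg_sub]
    exact pow_lt_one' hxa hp0
  -- coefficient form of the goal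
  refine Fintype.linearIndependent_iff.mpr fun g hg => ?_
  set k' : Subfield K := F₀.map (frobenius K p)
  have hgp : ∀ i, ((g i : K)) ^ p ∈ k' := fun i => Subfield.mem_map.mpr ⟨g i, (g i).2, hφ _⟩
  -- (B) the finite purely inseparable extension `M = k'(g x : x) ≤ F₀` of `k'`
  set M : IntermediateField ↥k' K :=
    IntermediateField.adjoin ↥k' (Set.range fun i : ↥(s : Set K) => ((g i : ↥F₀) : K))
  have hgM : ∀ i, ((g i : ↥F₀) : K) ∈ M := fun i => IntermediateField.subset_adjoin _ _ ⟨i, rfl⟩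
  haveI hMfin : FiniteDimensional ↥k' ↥M := IntermediateField.finiteDimensional_adjoin (by
    rintro _ ⟨i, rfl⟩
    exact IsIntegral.of_pow hp.pos (by
      rw [show ((g i : K)) ^ p = algebraMap ↥k' K ⟨_, hgp i⟩ from rfl]
      exact isIntegral_algebraMap))
  have hMp : ∀ z : K, z ∈ M → z ^ p ∈ k' := by
    have hle : M ≤ (k'.comap (frobenius K p)).toIntermediateField (fun y => by
        obtain ⟨x, hx, hxy⟩ := Subfield.mem_map.mp y.2
        refine Subfield.mem_comap.mpr (Subfield.mem_map.mpr ⟨x ^ p, pow_mem hx p, ?_⟩)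
        change _ = frobenius K p (y : K)
        rw [← hxy, hφ x]) := by
      rw [IntermediateField.adjoin_le_iff]
      rintro _ ⟨i, rfl⟩
      change frobenius K p (g i : K) ∈ k'
      rw [hφ]
      exact hgp i
    intro z hz
    rw [← hφ]
    exact hle hz
  -- (C) `O ∩ M` is the only extension of `O ∩ k'` to `M`, so `e · f = [M : k']`
  obtain ⟨T, hT, hsum⟩ := hdef' ↥M hMfin
  set W₀ : ValuationSubring ↥M := O.comap (algebraMap ↥M K) with hW₀def
  have hTW₀ : T = {W₀} := by
    refine Finset.eq_singleton_iff_unique_mem.mpr ⟨(hT W₀).mpr ?_, fun W hW => ?_⟩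
    · rw [hW₀def, ValuationSubring.comap_comap, ← IsScalarTower.algebraMap_eq]
    · have hW' := (hT W).mp hW
      ext z
      have hzp : z ^ p = algebraMap ↥k' ↥M ⟨(z : K) ^ p, hMp z z.2⟩ := Subtype.ext (by
        rw [IntermediateField.coe_pow]; rfl)
      rw [← pow_mem_iff_mem W hp0, hzp, ← ValuationSubring.mem_comap, hW',
        ValuationSubring.mem_comap, hW₀def, ValuationSubring.mem_comap,
        IntermediateField.algebraMap_apply]
      exact pow_mem_iff_mem O hp0 (z : K)
  rw [hTW₀, Finset.sum_singleton, hW₀def, ramificationIndex_comap_eq_relIndex O ↥k' M,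
    inertiaDegree_comap_eq_relfinrank O ↥k' M,
    Subfield.relfinrank_eq_finrank_of_le (residueSubfield_le_residueSubfield ↥k' ↥M O)] at hsum
  -- (E) representatives of `vM / vk'` in `M` and a residue basis of `Mv / k'v` in `M ∩ O`
  set Kp : Subfield K := (frobenius K p).fieldRange
  set vk := valueSubgroup ↥k' O
  set vM := valueSubgroup ↥M O
  set kv := residueSubfield ↥k' O
  set E := Subfield.extendScalars (residueSubfield_le_residueSubfield ↥k' ↥M O)
  set e := vk.relIndex vM
  set f := Module.finrank ↥kv ↥E
  have hn0 : 0 < Module.finrank ↥k' ↥M := Module.finrank_pos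
  have he0 : e ≠ 0 := fun h => by rw [h, zero_mul] at hsum; omega
  have hf0 : 0 < f := Nat.pos_of_ne_zero fun h => by rw [h, mul_zero] at hsum; omega
  have q : ↥vM ⧸ vk.subgroupOf vM ≃ Fin e :=
    Nat.equivFinOfCardPos (α := ↥vM ⧸ vk.subgroupOf vM) he0
  choose a' ha'0 ha'v using fun i : Fin e =>
    (mem_valueSubgroup_iff ↥M O _).mp ((q.symm i).out).2
  have ha0 : ∀ i, (a' i : K) ≠ 0 := fun i h => ha'0 i (by exact_mod_cast h)
  have hdist : ∀ i i', i ≠ i' →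
      (Units.mk0 (O.valuation (a' i : K)) ((Valuation.ne_zero_iff _).mpr (ha0 i)))⁻¹ *
        Units.mk0 (O.valuation (a' i' : K)) ((Valuation.ne_zero_iff _).mpr (ha0 i')) ∉ vk := by
    intro i i' hii' hmem
    have hmk : ∀ j, Units.mk0 (O.valuation (a' j : K)) ((Valuation.ne_zero_iff _).mpr (ha0 j)) =
        ((q.symm j).out : (ValuationSubring.ValueGroup O)ˣ) := fun j => Units.ext (ha'v j).symm
    rw [hmk, hmk] at hmem
    refine hii' (q.symm.injective ?_)
    rw [← QuotientGroup.out_eq' (q.symm i), ← QuotientGroup.out_eq' (q.symm i')]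
    exact QuotientGroup.eq.mpr (Subgroup.mem_subgroupOf.mpr hmem)
  haveI : Module.Finite ↥kv ↥E := Module.finite_of_finrank_pos hf0
  let Bres := Module.finBasis ↥kv ↥E
  choose b' hb'O hb'r using fun j : Fin f => (mem_residueSubfield_iff ↥M O _).mp (Bres j).2
  have hb : LinearIndependent ↥kv fun j => residue O ⟨algebraMap ↥M K (b' j), hb'O j⟩ := by
    have heq : (fun j => residue O ⟨algebraMap ↥M K (b' j), hb'O j⟩) =
        E.val.toLinearMap ∘ Bres := funext fun j => hb'r j
    rw [heq]
    exact Bres.linearIndependent.map' _ (LinearMap.ker_eq_bot.mpr Subtype.val_injective)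
  -- (F) the `e·f` products are `K^p`-linearly independent, hence a `k'`-basis of `M`
  have hkey := linearIndependent_mul_of_valuation_of_residue O Kp vk hH kv hL
    (fun i => (a' i : K)) ha0 hdist (fun j => ⟨algebraMap ↥M K (b' j), hb'O j⟩) hb
  have hli : LinearIndependent ↥k' fun m : Fin e × Fin f => a' m.1 * b' m.2 := by
    refine Fintype.linearIndependent_iff.mpr fun l hl m => ?_
    have h := Fintype.linearIndependent_iff.mp hkey (fun m => ⟨(l m : K), hk'Kp (l m).2⟩) ?_ m
    · have h' : ((l m : ↥k') : K) = 0 := congrArg Subtype.val h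
      exact Subtype.ext h'
    · have h2 := congrArg (algebraMap ↥M K) hl
      rw [map_sum, map_zero] at h2
      rw [← h2]
      refine Finset.sum_congr rfl fun m _ => ?_
      rw [Algebra.smul_def, Algebra.smul_def, map_mul, map_mul]
      rfl
  have hcard : Fintype.card (Fin e × Fin f) = Module.finrank ↥k' ↥M := by
    rw [Fintype.card_prod, Fintype.card_fin, Fintype.card_fin]; exact hsum
  set B := basisOfLinearIndependentOfCardEqFinrank' _ hli hcard with hBdef
  have hB : ∀ m, B m = a' m.1 * b' m.2 := fun m => by
    rw [hBdef, coe_basisOfLinearIndependentOfCardEqFinrank']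
  -- (G) kill the relation: expand the coefficients `g i ∈ M` in the basis
  have hα : ∀ i m, ∃ γ : K, γ ∈ F₀ ∧ γ ^ p = (B.repr ⟨(g i : K), hgM i⟩ m : K) := fun i m => by
    obtain ⟨γ, hγ, h⟩ := Subfield.mem_map.mp (B.repr ⟨(g i : K), hgM i⟩ m).2
    exact ⟨γ, hγ, by rw [← hφ]; exact h⟩
  choose γ hγF hγp using hα
  have hexp : ∀ i, ((g i : ↥F₀) : K) = ∑ m, (γ i m) ^ p * ((a' m.1 : K) * (b' m.2 : K)) := by
    intro i
    have h := congrArg (algebraMap ↥M K) (B.sum_repr ⟨(g i : K), hgM i⟩)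
    rw [map_sum] at h
    change algebraMap ↥M K ⟨(g i : K), hgM i⟩ = _
    rw [← h]
    refine Finset.sum_congr rfl fun m _ => ?_
    rw [hγp, hB, Algebra.smul_def, map_mul, map_mul]
    rfl
  have hδ : ∀ m, (∑ i, γ i m * (i : K)) = 0 := by
    have h := Fintype.linearIndependent_iff.mp hkey
      (fun m => ⟨(∑ i, γ i m * (i : K)) ^ p, ⟨_, hφ _⟩⟩) ?_
    · intro m
      exact (pow_eq_zero_iff hp0).mp (congrArg Subtype.val (h m))
    · calc ∑ m, (⟨(∑ i, γ i m * (i : K)) ^ p, ⟨_, hφ _⟩⟩ : ↥Kp) • ((a' m.1 : K) * (b' m.2 : K))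
          = ∑ m, ∑ i, (γ i m) ^ p * ((a' m.1 : K) * (b' m.2 : K)) * (i : K) ^ p := by
            refine Finset.sum_congr rfl fun m _ => ?_
            rw [Algebra.smul_def]
            change (∑ i, γ i m * (i : K)) ^ p * _ = _
            rw [← hφ, map_sum, Finset.sum_mul]
            refine Finset.sum_congr rfl fun i _ => ?_
            rw [hφ, mul_pow]
            ring
        _ = ∑ i, ((g i : ↥F₀) : K) * (i : K) ^ p := by
            rw [Finset.sum_comm]
            refine Finset.sum_congr rfl fun i _ => ?_
            rw [hexp, Finset.sum_mul]
        _ = 0 := by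
            rw [← hg]
            refine Finset.sum_congr rfl fun i _ => ?_
            rw [Algebra.smul_def]
            rfl
  have hγ0 : ∀ i m, γ i m = 0 := by
    intro i m
    have h := Fintype.linearIndependent_iff.mp hs (fun i => ⟨γ i m, hγF i m⟩) ?_ i
    · exact congrArg Subtype.val h
    · rw [← hδ m]
      refine Finset.sum_congr rfl fun i _ => ?_
      rw [Algebra.smul_def]
      rfl
  intro i
  apply Subtype.ext
  rw [hexp i]
  simp only [hγ0, zero_pow hp0, zero_mul, Finset.sum_const_zero, ZeroMemClass.coe_zero]

end Summit.ResolutionOfSingularities.ResolutionOfSingularities.Theorems.PfaffLine
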